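import Literature.NumberTheory.LFunctions.MatomakiRadziwillTaoLemmaA4
import Literature.NumberTheory.LFunctions.MatomakiRadziwillTaoPropA3OfT2
import Literature.NumberTheory.Sieve.MatomakiRadziwillProp1CoefAssembly
import Literature.NumberTheory.Sieve.MatomakiRadziwillLemma3VK
import HarnessLib

/-!
# Matomäki–Radziwiłł–Tao 2015, Proposition A.3 on `𝒯₂`, and Tao's Proposition 2.4 from Khale's region

Topic `Literature/NumberTheory/LFunctions`.  Everything in this file is PROVED (conditionally on the named fact
`Khale2024_zeroFreeRegion`, Khale's explicit Vinogradov–Korobov zero-free region for Dirichlet `L`-functions, the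
one classical input of Matomäki–Radziwiłł / Matomäki–Radziwiłł–Tao / Tao that the tree does not prove); no
definitions, no named facts.

This file completes the reduction of T. Tao, *The logarithmically averaged Chowla and Elliott conjectures for
two-point correlations*, Forum Math. Pi 4 (2016), Proposition 2.4 (the tree's named fact `Tao2016_prop24`) — and with
it Theorem 2.3, Theorem 1.3, Corollary 1.5 (`tao_log_chowla_two`) and parity.S21 for `λ` and `μ` — to that single
input:

* `minHalfDistSq_twist_ge_decay_cap`, `norm_sq_restrDirichlet_le_on_T2` — the pointwise bound
  `|F(1+it)|² ≪ (log X)^{-1/50}` on `𝒯₂ ∩ [−X/2, X/2]` for the `𝒮`-restricted polynomial `F = restrDirichlet f I X`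
  (restricted Halász, `HalaszRestrictedWindow.lean`), used for pieces of `𝒯₂` of length `< 1`;
* `T2half` — **Proposition A.3 of Matomäki–Radziwiłł–Tao on `𝒯₂`**: `∫_{T₀}^{T} |F|² ≪ (T/(X/Q₁)+1)((log Q₁)^{1/3}/P₁^{1/6−η}
  + (log X)^{-1/50})` for `[T₀, T] ⊆ [0, X/2]` at distance `≥ (log X)^{1/16}` from the minimiser `t₁`, from
  Matomäki–Radziwiłł's Proposition 1 for general coefficients (`Sieve.prop1_coef_of_lemma11`,
  `MatomakiRadziwillProp1CoefAssembly.lean`; Lemma 11 from Khale, `Sieve.MatomakiRadziwill2016_lemma11_of_khale`) with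
  `a = f 1_𝒮`, `b_j = f 1_{𝒮_j}`, `c = f` and the Halász input of Lemma A.4 (`exists_cofactor_bound`,
  `MatomakiRadziwillTaoLemmaA4.lean`);
* `propA3With_exp_half_of_T2half` (the assembly of `MatomakiRadziwillTaoPropA3OfT2.lean` with `T ≤ X/2` on the pieces),
  `propA3With_exp_half_of_khale` — `∃ K ≥ 0, MRT2015.PropA3With (fun M => K (1 + M) e^{-M/2})`;
* `Tao2016_prop24_of_khale : Khale2024_zeroFreeRegion → Tao2016_prop24`, and `Tao2016_theorem23_of_khale`,
  `tao_log_averaged_elliott_two_of_khale`, `tao_log_chowla_two_of_khale`, `tao_log_chowla_liouville_of_khale`,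
  `tao_log_chowla_moebius_of_khale`.

## References
* K. Matomäki, M. Radziwiłł, T. Tao, Algebra & Number Theory 9 (2015) (arXiv:1503.05121), Appendix A, Proposition A.3
  and its proof, Lemma A.4. [cite: MatomakiRadziwillTao2015, Appendix A, Proposition A.3 (proof)]
* K. Matomäki, M. Radziwiłł, Ann. of Math. (2) 183 (2016), Proposition 1 (§8). [cite: MatomakiRadziwillAnnals2016, Proposition 1]
* T. Tao, Forum Math. Pi 4 (2016), e8, Proposition 2.4, Theorem 2.3, Theorem 1.3, Corollary 1.5.
  [cite: TaoFMP2016, Proposition 2.4]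
* T. Khale, Q. J. Math. 75 (2024), Theorem 1.1. [cite: Khale2024, Theorem 1.1]
-/

noncomputable section

open Finset Real Complex Filter MeasureTheory
open scoped ComplexConjugate Classical

namespace Literature.NumberTheory.LFunctions

namespace MRT2015

open Sieve (SieveIntervalSystem minPretentiousDistSq minPretentiousDistSq_nonneg pretentiousDistSq blockCofactorPoly)
open Halasz.Restricted (MemBlocks IsBlockSystem minHalfDistSq halfDistSq)

variable {η X₀ : ℝ}

/-! ### The pointwise decaying bound on `𝒯₂` (pieces of length `≤ 1`) -/

/-- The decaying halved-distance floor with a capped Halász window `D/2`, `8 ≤ D ≤ min(|t − t₁|, X/4)`, `|t| ≤ X/2`,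
`|t₁| ≤ X` (the proof of `Halasz.Restricted.minHalfDistSq_twist_ge_decay` with `D` for `|t − t₁|`).
[cite: MatomakiRadziwillTao2015, Appendix A, Proposition A.3 (proof)] -/
theorem minHalfDistSq_twist_ge_decay_cap (hK : Khale2024_zeroFreeRegion) {θ : ℝ} (hθ : 2 / 3 < θ) (hθ1 : θ < 1) :
    ∀ᶠ X : ℝ in atTop, ∀ (g : ℕ → ℂ), (∀ n, ‖g n‖ ≤ 1) → ∀ (E : Finset ℕ),
      (∀ p ∈ E, (p : ℝ) ≤ Real.exp (Real.sqrt (Real.log X))) →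
      ∀ (t t₁ D y : ℝ),
        pretentiousDistSq g (fun n : ℕ => (n : ℂ) ^ ((t₁ : ℂ) * Complex.I)) X ≤ minPretentiousDistSq g X X + 0 →
        |t| ≤ X / 2 → |t₁| ≤ X → 8 ≤ D → D ≤ |t - t₁| → D ≤ X / 4 → X - 1 ≤ y → y ≤ 2 * X →
        (Real.log (Real.log (X - 1)) - θ * Real.log (Real.log (2 * X)) - 6) / 4 - (0 + 4) / 2 ≤
          minHalfDistSq E (fun n : ℕ => g n * (n : ℂ) ^ (-((t : ℂ) * Complex.I))) y (D / 2) := by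
  have h2 : Tendsto (fun x : ℝ => 2 * x) atTop atTop := tendsto_id.const_mul_atTop (by norm_num)
  filter_upwards [h2.eventually (TwistedPrimeSumTail.halfDistSq_ge_of_far_from_minimiser hK hθ),
    Halasz.Restricted.eventually_exp_rpow_log_le (θ := θ) (by linarith) hθ1,
    Halasz.Restricted.eventually_exp_sqrt_log_le (θ := θ) (by linarith),
    eventually_ge_atTop (4 : ℝ)] with X hfar hexp hsqrt hX4
  intro g hgb E hE t t₁ D y hmin ht ht₁ h8 hDt hDX hy1 hy2
  have hT' : 0 ≤ D / 2 := by linarith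
  have hne : Nonempty (Set.Icc (-(D / 2)) (D / 2)) := ⟨⟨0, by simp [hT']⟩⟩
  unfold minHalfDistSq
  refine le_ciInf fun u => ?_
  rw [Halasz.Restricted.halfDistSq_mul_twist]
  have hu : |(u : ℝ)| ≤ D / 2 := abs_le.2 ⟨u.2.1, u.2.2⟩
  have hE' : ∀ p ∈ E, (p : ℝ) ≤ Real.exp (Real.log (2 * X) ^ θ) - 1 := fun p hp => (hE p hp).trans hsqrt
  have hyP : Real.exp (Real.log (2 * X) ^ θ) ≤ y := hexp.trans hy1
  have hs : |t + (u : ℝ)| ≤ X := by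
    have := abs_add_le t (u : ℝ); linarith
  have hmin' := Halasz.Restricted.near_min_of_height_mem hgb hX4 (by linarith : (0 : ℝ) ≤ X) hmin hy1 hy2
  have habs1 : |t - t₁| ≤ |t + (u : ℝ) - t₁| + |(u : ℝ)| :=
    calc |t - t₁| = |(t + (u : ℝ) - t₁) - (u : ℝ)| := by congr 1; ring
      _ ≤ |t + (u : ℝ) - t₁| + |(u : ℝ)| := abs_sub _ _
  have habs2 : |t + (u : ℝ) - t₁| ≤ |t| + |(u : ℝ)| + |t₁| := by
    calc |t + (u : ℝ) - t₁| ≤ |t + (u : ℝ)| + |t₁| := abs_sub _ _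
      _ ≤ |t| + |(u : ℝ)| + |t₁| := by linarith [abs_add_le t (u : ℝ)]
  have h1 : 1 ≤ |t + (u : ℝ) - t₁| := by linarith
  have h2' : |t + (u : ℝ) - t₁| ≤ 2 * X := by linarith
  have hmain := hfar g hgb E hE' y X (t + u) t₁ (0 + 4) hyP hy2 hs hmin' h1 h2'
  have hll : Real.log (Real.log (X - 1)) ≤ Real.log (Real.log y) :=
    Real.log_le_log (Real.log_pos (by linarith)) (Real.log_le_log (by linarith) hy1)
  linarith

set_option maxHeartbeats 800000 in
/-- **The pointwise bound on `𝒯₂`**: assuming Khale's theorem, there is `K'` such that for all large `X`, every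
`0 < η ≤ 1`, `√X ≤ X₀ ≤ X`, `I : SieveIntervalSystem η X₀`, completely multiplicative `|f| ≤ 1`, a minimiser `t₁`
(`|t₁| ≤ X`, `𝔻(f, n^{it₁}; X)² ≤ M(f;X)`) and `|t| ≤ X/2` with `|t − t₁| ≥ (log X)^{1/16}`:
`|F(1+it)|² ≤ K' (log X)^{-1/50}` (`F = restrDirichlet f I X`).  From `Halasz.Restricted.norm_restr_dirichlet_le` with the
window `D/2`, `D = min(|t − t₁|, X/4)`, the floor `minHalfDistSq_twist_ge_decay_cap` (`θ = 7/10`) and the error-term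
bookkeeping of `MatomakiRadziwillTaoPropA3Window.lean`. [cite: MatomakiRadziwillTao2015, Appendix A, Proposition A.3 (proof)] -/
theorem norm_sq_restrDirichlet_le_on_T2 (hK : Khale2024_zeroFreeRegion) :
    ∃ K' : ℝ, 0 < K' ∧ ∀ᶠ X : ℝ in atTop, ∀ (η X₀ : ℝ) (I : SieveIntervalSystem η X₀) (f : ℕ → ℂ),
      0 < η → η ≤ 1 → (∀ m n : ℕ, f (m * n) = f m * f n) → f 1 = 1 → (∀ n, ‖f n‖ ≤ 1) →
      Real.sqrt X ≤ X₀ → X₀ ≤ X →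
      ∀ t₁ t : ℝ, |t₁| ≤ X →
        pretentiousDistSq f (fun n : ℕ => (n : ℂ) ^ ((t₁ : ℂ) * Complex.I)) X ≤ minPretentiousDistSq f X X →
        |t| ≤ X / 2 → Real.log X ^ (1 / 16 : ℝ) ≤ |t - t₁| →
        ‖restrDirichlet f I X t‖ ^ 2 ≤ K' / Real.log X ^ (1 / 50 : ℝ) := by
  obtain ⟨K, hK0, hH⟩ := Halasz.Restricted.norm_restr_dirichlet_le
  refine ⟨3 * K ^ 2 * (16 * Real.exp 6 + 4 + 225), by positivity, ?_⟩
  filter_upwards [minHalfDistSq_twist_ge_decay_cap hK (θ := 7 / 10) (by norm_num) (by norm_num),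
    eventually_ge_atTop (64 : ℝ), Real.tendsto_log_atTop.eventually_ge_atTop (5 : ℝ),
    (Real.tendsto_log_atTop.comp Real.tendsto_log_atTop).eventually_ge_atTop (48 : ℝ)] with X hdec hX64 hℓ5 hll
  intro η X₀ I f hη hη1 hf hf1 hfb hX₀ hX₀X t₁ t ht₁ hmin ht hfar
  have hη8 : η ≤ 8 := by linarith
  have hX0 : 0 < X := by linarith
  have hX4 : 4 ≤ X := by linarith
  set ℓ : ℝ := Real.log X with hℓdef
  set lam : ℝ := Real.log ℓ with hlamdef
  have hlam48 : 48 ≤ lam := hll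
  have hℓ0 : 0 < ℓ := by linarith
  have hℓ1 : 1 ≤ ℓ := by linarith
  have hℓ4 : 4 ≤ ℓ := by linarith
  have hlam0 : 0 ≤ lam := by linarith
  -- `L' = ℓ^{1/16} ≥ 16`, `L' ≤ X/4`
  set L' : ℝ := ℓ ^ (1 / 16 : ℝ) with hL'def
  have hL'exp : L' = Real.exp (lam / 16) := by rw [hL'def, Real.rpow_def_of_pos hℓ0, hlamdef]; ring_nf
  have he3 : (16 : ℝ) ≤ Real.exp 3 := by
    have h := Real.exp_one_gt_d9
    have h3 : Real.exp 3 = Real.exp 1 ^ 3 := by rw [← Real.exp_nat_mul]; norm_num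
    have h4 : (2.7182818283 : ℝ) ^ 3 ≤ Real.exp 1 ^ 3 := pow_le_pow_left₀ (by norm_num) h.le 3
    rw [h3]; exact le_trans (by norm_num) h4
  have h16L : 16 ≤ L' := by rw [hL'exp]; exact he3.trans (Real.exp_le_exp.2 (by linarith))
  have hLX : L' ≤ X / 4 := by
    have h1 : L' ≤ ℓ := by
      rw [hL'def]
      calc ℓ ^ (1 / 16 : ℝ) ≤ ℓ ^ (1 : ℝ) := Real.rpow_le_rpow_of_exponent_le hℓ1 (by norm_num)
        _ = ℓ := Real.rpow_one ℓ
    have h2 : ℓ ≤ X ^ (1 / 2 : ℝ) / (1 / 2) := Real.log_le_rpow_div hX0.le (by norm_num)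
    have h3 : X ^ (1 / 2 : ℝ) ≤ X / 8 := by
      rw [← Real.sqrt_eq_rpow]
      have hs8 : 8 ≤ Real.sqrt X := by
        rw [show (8 : ℝ) = Real.sqrt 64 by rw [show (64:ℝ) = 8 ^ 2 by norm_num, Real.sqrt_sq (by norm_num)]]
        exact Real.sqrt_le_sqrt hX64
      nlinarith [Real.mul_self_sqrt hX0.le, Real.sqrt_nonneg X]
    have : ℓ ≤ X / 4 := by rw [le_div_iff₀ (by norm_num)] at h2 ⊢; linarith
    exact h1.trans this
  -- the block system of `I`, `Q = exp(√ℓ)`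
  set Q : ℝ := Real.exp (Real.sqrt ℓ) with hQdef
  have hs2 : 2 ≤ Real.sqrt ℓ := by
    rw [show (2 : ℝ) = Real.sqrt 4 by rw [show (4:ℝ) = 2 ^ 2 by norm_num, Real.sqrt_sq (by norm_num)]]
    exact Real.sqrt_le_sqrt hℓ4
  have hQ2 : Real.exp 2 ≤ Q := Real.exp_le_exp.2 hs2
  have hsX : 0 < Real.sqrt X := Real.sqrt_pos.2 hX0
  have hX₀0 : 0 < X₀ := hsX.trans_le hX₀
  have hQJ : I.Q I.J ≤ Q :=
    I.Q_J_le.trans (Real.exp_le_exp.2 (Real.sqrt_le_sqrt (Real.log_le_log hX₀0 hX₀X)))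
  have hQX1 : Q ≤ X - 1 := by
    have h1 : Real.sqrt ℓ ≤ ℓ / 2 := by nlinarith [Real.mul_self_sqrt hℓ0.le, Real.sqrt_nonneg ℓ]
    have h2 : Real.exp (ℓ / 2) = Real.sqrt X := by
      rw [Real.sqrt_eq_rpow, Real.rpow_def_of_pos hX0, hℓdef]; ring_nf
    have h3 : Real.sqrt X ≤ X - 1 := by
      have hs8 : 8 ≤ Real.sqrt X := by
        rw [show (8 : ℝ) = Real.sqrt 64 by rw [show (64:ℝ) = 8 ^ 2 by norm_num, Real.sqrt_sq (by norm_num)]]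
        exact Real.sqrt_le_sqrt hX64
      nlinarith [Real.mul_self_sqrt hX0.le]
    calc Q ≤ Real.exp (ℓ / 2) := Real.exp_le_exp.2 h1
      _ = Real.sqrt X := h2
      _ ≤ X - 1 := h3
  have hN : I.Q I.J ≤ ((⌈X⌉₊ - 1 : ℕ) : ℝ) := by
    have h1 : 1 ≤ ⌈X⌉₊ := Nat.one_le_iff_ne_zero.2 (by simpa using hX0)
    rw [Nat.cast_sub h1, Nat.cast_one]
    have h2 : X ≤ ⌈X⌉₊ := Nat.le_ceil X
    linarith
  have hsys := isBlockSystem I hη hη8 hN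
  have hblkQ : ∀ i ∈ Finset.Icc 1 I.J, ∀ p ∈ (Finset.Icc ⌈I.P i⌉₊ ⌊I.Q i⌋₊).filter Nat.Prime, (p : ℝ) ≤ Q :=
    fun i hi p hp => (primeBlock_le_Q_J I hη hη8 i hi p hp).trans hQJ
  have hE : ∀ p ∈ (Finset.Icc 1 I.J).biUnion (fun j => (Finset.Icc ⌈I.P j⌉₊ ⌊I.Q j⌋₊).filter Nat.Prime),
      (p : ℝ) ≤ Real.exp (Real.sqrt (Real.log X)) := by
    intro p hp
    rw [Finset.mem_biUnion] at hp
    obtain ⟨i, hi, hpi⟩ := hp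
    exact hblkQ i hi p hpi
  -- the window `D = min(|t - t₁|, X/4)` and the floor
  set D : ℝ := min |t - t₁| (X / 4) with hDdef
  have hDt : D ≤ |t - t₁| := min_le_left _ _
  have hDX : D ≤ X / 4 := min_le_right _ _
  have hL'D : L' ≤ D := le_min hfar hLX
  have h8D : 8 ≤ D := by linarith
  set M₁ : ℝ := (Real.log (Real.log (X - 1)) - 7 / 10 * Real.log (Real.log (2 * X)) - 6) / 4 - (0 + 4) / 2
    with hM₁def
  set Mp : ℝ := max 0 M₁ with hMpdef
  have hMp0 : 0 ≤ Mp := le_max_left _ _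
  have hmin0 : pretentiousDistSq f (fun n : ℕ => (n : ℂ) ^ ((t₁ : ℂ) * Complex.I)) X ≤
      minPretentiousDistSq f X X + 0 := by linarith
  have hwin : ∀ y : ℝ, X - 1 ≤ y → y ≤ 2 * X →
      Mp ≤ minHalfDistSq ((Finset.Icc 1 I.J).biUnion (fun j => (Finset.Icc ⌈I.P j⌉₊ ⌊I.Q j⌋₊).filter Nat.Prime))
        (fun n : ℕ => f n * (n : ℂ) ^ (-((t : ℂ) * Complex.I))) y (D / 2) := by
    intro y hy1 hy2
    refine max_le (Halasz.Restricted.minHalfDistSq_nonneg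
      (Halasz.Restricted.norm_mul_twist_le hfb t) _ y (by linarith)) ?_
    exact hdec f hfb _ hE t t₁ D y hmin0 ht ht₁ h8D hDt hDX hy1 hy2
  have hpt := hH (Finset.Icc 1 I.J) (fun j => (Finset.Icc ⌈I.P j⌉₊ ⌊I.Q j⌋₊).filter Nat.Prime) f hf hf1 hfb t X
    (D / 2) Q Mp hX4 (by linarith) hQ2 hsys hblkQ hMp0 hwin
  rw [← restrDirichlet_eq_sum_memBlocks f I hX0 t] at hpt
  -- the error terms
  set u : ℝ := (1 + Mp) * Real.exp (-Mp) with hudef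
  set ρ : ℝ := Real.sqrt ((Real.log Q + 2) / Real.log X) with hρdef
  set Jr : ℝ := ((Finset.Icc 1 I.J).card : ℝ) + 1 with hJrdef
  have hJr0 : 0 ≤ Jr := by positivity
  have hJr : Jr ≤ 3 + lam := by
    have hcard : ((Finset.Icc 1 I.J).card : ℝ) = I.J := by rw [Nat.card_Icc]; simp
    have hexp2 : Real.exp 1 ^ 2 ≤ X :=
      le_trans (le_trans (pow_le_pow_left₀ (Real.exp_pos 1).le Real.exp_one_lt_d9.le 2) (by norm_num)) hX64
    have he1 : Real.exp 1 ≤ X₀ := by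
      refine le_trans ?_ hX₀
      rw [← Real.sqrt_sq (Real.exp_pos 1).le]
      exact Real.sqrt_le_sqrt hexp2
    have h1 := J_add_one_le I hη hη1 he1
    have h2 : Real.log (Real.log X₀) ≤ lam := by
      have hX₀1 : 1 ≤ Real.log X₀ := by
        rw [← Real.log_exp 1]; exact Real.log_le_log (Real.exp_pos 1) he1
      exact Real.log_le_log (by linarith) (Real.log_le_log hX₀0 hX₀X)
    rw [hJrdef, hcard]; linarith
  have hρ0 : 0 ≤ ρ := Real.sqrt_nonneg _
  have hρ : ρ ≤ Real.sqrt 2 * Real.exp (-(lam / 4)) := by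
    rw [hρdef, hQdef, Real.log_exp]; exact sqrt_ratio_le hℓ4
  have hu0 : 0 ≤ u := by positivity
  have hu : u ^ 2 ≤ 16 * Real.exp 6 * Real.exp (-(9 / 80 * lam)) := by
    have h1 := sq_one_add_mul_exp_neg_le (le_max_left 0 M₁)
    have h2 : Real.exp (-(3 / 2 * max 0 M₁)) ≤ Real.exp (-(3 / 2 * M₁)) :=
      Real.exp_le_exp.2 (by linarith [le_max_right 0 M₁])
    have h3 := exp_neg_threeHalves_M₁_le (by linarith : (8 : ℝ) ≤ X)
    rw [hudef]
    calc ((1 + max 0 M₁) * Real.exp (-max 0 M₁)) ^ 2 ≤ 16 * Real.exp (-(3 / 2 * max 0 M₁)) := h1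
      _ ≤ 16 * Real.exp (-(3 / 2 * M₁)) := by linarith
      _ ≤ 16 * (Real.exp 6 * Real.exp (-(9 / 80 * lam))) := by
          refine mul_le_mul_of_nonneg_left ?_ (by norm_num)
          simpa only [hM₁def, hlamdef, hℓdef] using h3
      _ = 16 * Real.exp 6 * Real.exp (-(9 / 80 * lam)) := by ring
  -- `|F| ≤ K (u + 2/D + Jr ρ)`, `2/D ≤ 2/L' = 2 e^{-lam/16}`
  have hFle : ‖restrDirichlet f I X t‖ ≤ K * (u + 2 / L' + Jr * ρ) := by
    have h1 : 1 / (D / 2) ≤ 2 / L' := by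
      rw [div_le_div_iff₀ (by linarith) (by linarith)]; linarith
    refine hpt.trans ?_
    rw [hudef, hJrdef, hρdef]
    gcongr
  have hF0 : 0 ≤ ‖restrDirichlet f I X t‖ := norm_nonneg _
  -- squares: `|F|² ≤ 3K²(u² + 4/L'² + Jr²ρ²)`
  set E : ℝ := Real.exp (-(lam / 50)) with hEdef
  have hE0 : 0 < E := Real.exp_pos _
  have hmono : ∀ c : ℝ, c ≤ -(lam / 50) → Real.exp c ≤ E := fun c hc => Real.exp_le_exp.2 hc
  have hT1 : (2 / L') ^ 2 ≤ 4 * E := by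
    rw [hL'exp, div_pow, ← Real.exp_nat_mul]
    push_cast
    rw [show (2:ℝ)^2 = 4 by norm_num, div_eq_mul_inv, ← Real.exp_neg]
    exact mul_le_mul_of_nonneg_left (hmono _ (by linarith)) (by norm_num)
  have hJρ : Jr * ρ ≤ 15 * Real.exp (-(3 / 20 * lam)) := by
    have hJr' : Jr ≤ 10 * Real.exp (lam / 10) := hJr.trans (three_add_le_exp lam)
    have hsqrt2 : Real.sqrt 2 ≤ 3 / 2 := by
      rw [show (3 / 2 : ℝ) = Real.sqrt ((3 / 2) ^ 2) by rw [Real.sqrt_sq (by norm_num)]]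
      exact Real.sqrt_le_sqrt (by norm_num)
    have h1 : Jr * ρ ≤ (10 * Real.exp (lam / 10)) * (Real.sqrt 2 * Real.exp (-(lam / 4))) :=
      mul_le_mul hJr' hρ hρ0 (by positivity)
    have h2 : (10 * Real.exp (lam / 10)) * (Real.sqrt 2 * Real.exp (-(lam / 4))) =
        10 * Real.sqrt 2 * Real.exp (-(3 / 20 * lam)) := by
      rw [show -(3 / 20 * lam) = lam / 10 + -(lam / 4) by ring, Real.exp_add]; ring
    rw [h2] at h1
    exact h1.trans (mul_le_mul_of_nonneg_right (by linarith) (Real.exp_pos _).le)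
  have hJρ0 : 0 ≤ Jr * ρ := mul_nonneg hJr0 hρ0
  have hT3 : (Jr * ρ) ^ 2 ≤ 225 * E := by
    have h1 : (Jr * ρ) ^ 2 ≤ (15 * Real.exp (-(3 / 20 * lam))) ^ 2 := pow_le_pow_left₀ hJρ0 hJρ 2
    have h2 : (15 * Real.exp (-(3 / 20 * lam))) ^ 2 = 225 * Real.exp (-(3 / 20 * lam) + -(3 / 20 * lam)) := by
      rw [Real.exp_add]; ring
    rw [h2] at h1
    exact h1.trans (mul_le_mul_of_nonneg_left (hmono _ (by linarith)) (by norm_num))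
  have hT4 : u ^ 2 ≤ 16 * Real.exp 6 * E :=
    hu.trans (mul_le_mul_of_nonneg_left (hmono _ (by linarith)) (by positivity))
  have hEeq : E = 1 / ℓ ^ (1 / 50 : ℝ) := by
    rw [hEdef, hlamdef, Real.rpow_def_of_pos hℓ0, one_div, ← Real.exp_neg]; ring_nf
  have hsq : ‖restrDirichlet f I X t‖ ^ 2 ≤ (K * (u + 2 / L' + Jr * ρ)) ^ 2 := pow_le_pow_left₀ hF0 hFle 2
  have hexpand : (u + 2 / L' + Jr * ρ) ^ 2 ≤ 3 * (u ^ 2 + (2 / L') ^ 2 + (Jr * ρ) ^ 2) := by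
    nlinarith [sq_nonneg (u - 2 / L'), sq_nonneg (u - Jr * ρ), sq_nonneg (2 / L' - Jr * ρ)]
  have hK2 : 0 ≤ K ^ 2 := sq_nonneg K
  calc ‖restrDirichlet f I X t‖ ^ 2 ≤ (K * (u + 2 / L' + Jr * ρ)) ^ 2 := hsq
    _ = K ^ 2 * (u + 2 / L' + Jr * ρ) ^ 2 := by ring
    _ ≤ K ^ 2 * (3 * (u ^ 2 + (2 / L') ^ 2 + (Jr * ρ) ^ 2)) := mul_le_mul_of_nonneg_left hexpand hK2
    _ ≤ K ^ 2 * (3 * (16 * Real.exp 6 * E + 4 * E + 225 * E)) := by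
        refine mul_le_mul_of_nonneg_left ?_ hK2
        linarith
    _ = 3 * K ^ 2 * (16 * Real.exp 6 + 4 + 225) / Real.log X ^ (1 / 50 : ℝ) := by
        rw [hEeq, hℓdef]; ring

/-! ### The range `𝒯₂`: Matomäki–Radziwiłł's Proposition 1 for complex `f` away from the minimiser -/

set_option maxHeartbeats 1600000 in
/-- **Proposition A.3 on `𝒯₂`** ("In the region `|t − t₁| ≥ (log X)^{1/16}`, the above implies the following in
exactly the same way as [MR]"): assuming Khale's theorem, for `η ∈ (0, 1/6)` there are `C, Xη` such that for `X > Xη`,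
`√X ≤ X₀ ≤ X`, `I : SieveIntervalSystem η X₀`, completely multiplicative `f : ArithmeticFunction ℂ` with `|f| ≤ 1`, a
minimiser `t₁` of `u ↦ 𝔻(f, n^{iu}; X)²` on `|u| ≤ X` and every interval `[T₀, T] ⊆ [0, X/2]` on which
`|t − t₁| ≥ (log X)^{1/16}`,
`∫_{T₀}^{T} |F(1+it)|² dt ≤ C (T/(X/Q₁) + 1) ((log Q₁)^{1/3}/P₁^{1/6-η} + (log X)^{-1/50})`.
Pieces with `T < 1` by the pointwise bound `norm_sq_restrDirichlet_le_on_T2`; otherwise MR's Proposition 1 for the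
coefficients `a = f 1_𝒮`, `b_j = f 1_{𝒮_j}`, `c = f` (`Sieve.prop1_coef_of_lemma11` with Lemma 11 from Khale,
`Sieve.MatomakiRadziwill2016_lemma11_of_khale`) and the Halász input `exists_cofactor_bound`.
[cite: MatomakiRadziwillTao2015, Appendix A, Proposition A.3 (proof)] [cite: MatomakiRadziwillAnnals2016, Proposition 1] -/
theorem T2half (hK : Khale2024_zeroFreeRegion) :
    ∀ η : ℝ, 0 < η → η < 1 / 6 → ∃ C Xη : ℝ, ∀ (X X₀ T₀ T t₁ : ℝ) (I : SieveIntervalSystem η X₀)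
      (f : ArithmeticFunction ℂ), (∀ m n : ℕ, f (m * n) = f m * f n) → f 1 = 1 → (∀ n, ‖f n‖ ≤ 1) →
      Xη < X → Real.sqrt X ≤ X₀ → X₀ ≤ X → |t₁| ≤ X →
      pretentiousDistSq f (fun n : ℕ => (n : ℂ) ^ ((t₁ : ℂ) * Complex.I)) X = minPretentiousDistSq f X X →
      0 ≤ T₀ → T₀ ≤ T → T ≤ X / 2 →
      (∀ t ∈ Set.Icc T₀ T, Real.log X ^ (1 / 16 : ℝ) ≤ |t - t₁|) →
      ∫ t in T₀..T, ‖restrDirichlet f I X t‖ ^ 2 ≤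
        C * (T / (X / I.Q 1) + 1) *
          (Real.log (I.Q 1) ^ (1 / 3 : ℝ) / (I.P 1) ^ (1 / 6 - η) + 1 / Real.log X ^ (1 / 50 : ℝ)) := by
  intro η hη hη6
  have hη8 : η ≤ 8 := by linarith
  obtain ⟨C₃, hC₃0, hRev⟩ := exists_cofactor_bound hK
  obtain ⟨C₁, L₀, hC₁0, hP1⟩ := Sieve.prop1_coef_of_lemma11 (Sieve.MatomakiRadziwill2016_lemma11_of_khale hK) hη hη6 C₃
  obtain ⟨K', hK'0, hptev⟩ := norm_sq_restrDirichlet_le_on_T2 hK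
  obtain ⟨X₁, hX₁⟩ := Filter.eventually_atTop.1 (hRev.and (hptev.and
    ((Real.tendsto_log_atTop.eventually_ge_atTop L₀).and (eventually_ge_atTop (Real.exp 4)))))
  refine ⟨C₁ + K', X₁, ?_⟩
  intro X X₀ T₀ T t₁ I f hf hf1 hfb hXη hX₀ hX₀X ht₁ heq hT₀ hT₀T hTX hfar
  obtain ⟨hR, hpt, hL₀, hXe4⟩ := hX₁ X hXη.le
  have hX0 : 0 < X := (Real.exp_pos 4).trans_le hXe4
  have hX1 : 1 ≤ X := by have := Real.add_one_le_exp (4:ℝ); linarith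
  have hsX : 0 < Real.sqrt X := Real.sqrt_pos.2 hX0
  have hX₀0 : 0 < X₀ := hsX.trans_le hX₀
  have hlogX : 0 < Real.log X := Real.log_pos (by have := Real.add_one_le_exp (4:ℝ); linarith)
  -- common quantities
  set E₁ : ℝ := Real.log (I.Q 1) ^ (1 / 3 : ℝ) / I.P 1 ^ (1 / 6 - η) with hE₁
  set E₃ : ℝ := 1 / Real.log X ^ (1 / 50 : ℝ) with hE₃
  set R : ℝ := T / (X / I.Q 1) + 1 with hRdef
  have hQ1 : 1 ≤ I.Q 1 := I.one_le_Q hη hη8 le_rfl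
  have hP0 : 0 < I.P 1 := I.pos_P 1 le_rfl
  have hE₁0 : 0 ≤ E₁ := by
    have : 0 ≤ Real.log (I.Q 1) := Real.log_nonneg hQ1
    positivity
  have hE₃0 : 0 ≤ E₃ := by positivity
  have hT0 : 0 ≤ T := hT₀.trans hT₀T
  have hR1 : 1 ≤ R := by
    have : 0 ≤ T / (X / I.Q 1) := by positivity
    linarith
  have hR0 : 0 ≤ R := by linarith
  -- the minimiser property in the form of `exists_cofactor_bound`
  have hmin : ∀ u : ℝ, |u| ≤ X → pretentiousDistSq f (fun n : ℕ => (n : ℂ) ^ ((t₁ : ℂ) * Complex.I)) X ≤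
      pretentiousDistSq f (fun n : ℕ => (n : ℂ) ^ ((u : ℂ) * Complex.I)) X := by
    intro u hu; rw [heq]; exact Halasz.minPretentiousDistSq_le_of_abs_le hfb X hu
  rcases lt_or_ge T 1 with hT1 | hT1
  · -- pieces of length `< 1`: the pointwise bound
    have hcont : Continuous fun t : ℝ => ‖restrDirichlet f I X t‖ ^ 2 :=
      ((continuous_restrDirichlet f I X).norm).pow 2
    have hptw : ∀ t ∈ Set.Icc T₀ T, ‖restrDirichlet f I X t‖ ^ 2 ≤ K' / Real.log X ^ (1 / 50 : ℝ) := by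
      intro t ht
      refine hpt η X₀ I f hη (by linarith) hf hf1 hfb hX₀ hX₀X t₁ t ht₁ heq.le ?_ (hfar t ht)
      rw [abs_of_nonneg (hT₀.trans ht.1)]; linarith [ht.2]
    have h1 : ∫ t in T₀..T, ‖restrDirichlet f I X t‖ ^ 2 ≤ ∫ t in T₀..T, K' / Real.log X ^ (1 / 50 : ℝ) :=
      intervalIntegral.integral_mono_on hT₀T (hcont.intervalIntegrable _ _) intervalIntegrable_const
        (fun t ht => hptw t ht)
    rw [intervalIntegral.integral_const, smul_eq_mul] at h1
    have h2 : (T - T₀) * (K' / Real.log X ^ (1 / 50 : ℝ)) ≤ K' * E₃ := by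
      have : K' / Real.log X ^ (1 / 50 : ℝ) = K' * E₃ := by rw [hE₃]; ring
      rw [this]
      have hKE : 0 ≤ K' * E₃ := by positivity
      nlinarith
    have h3 : K' * E₃ ≤ (C₁ + K') * R * (E₁ + E₃) := by
      have a1 : K' * E₃ ≤ K' * (E₁ + E₃) := by nlinarith
      have a2 : K' * (E₁ + E₃) ≤ K' * R * (E₁ + E₃) := by
        have : 0 ≤ K' * (E₁ + E₃) := by positivity
        nlinarith
      nlinarith [mul_nonneg (mul_nonneg hC₁0 hR0) (add_nonneg hE₁0 hE₃0)]
    linarith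
  · -- `T ≥ 1`: Proposition 1 for the coefficients `a = f 1_𝒮`, `b_j = f 1_{𝒮_j}`, `c = f`
    set a : ℕ → ℂ := fun n => if I.Mem n then f n else 0 with ha
    set b : ℕ → ℕ → ℂ := fun j m => if I.MemExcept j m then f m else 0 with hb
    have ha1 : ∀ n, ‖a n‖ ≤ 1 := fun n => by
      simp only [ha]; split_ifs
      · exact hfb n
      · simp
    have hb1 : ∀ j m, ‖b j m‖ ≤ 1 := fun j m => by
      simp only [hb]; split_ifs
      · exact hfb m
      · simp
    have hsupp : ∀ n, a n ≠ 0 → I.Mem n := fun n hn => by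
      by_contra h; simp only [ha, if_neg h] at hn; exact hn rfl
    have hfac : ∀ j ∈ Icc 1 I.J, ∀ m p : ℕ, p.Prime → I.P j ≤ p → (p : ℝ) ≤ I.Q j → ¬ p ∣ m →
        a (m * p) = b j m * f p := by
      intro j hj m p hp hPp hpQ hpm
      have hm : m ≠ 0 := by rintro rfl; exact hpm (dvd_zero p)
      simp only [ha, hb]
      rw [hf m p]
      by_cases h : I.MemExcept j m
      · rw [if_pos ((I.mem_mul_prime_iff hη hη8 hj hm hp hPp hpQ).2 h), if_pos h]
      · rw [if_neg (fun h' => h ((I.mem_mul_prime_iff hη hη8 hj hm hp hPp hpQ).1 h')), if_neg h, zero_mul]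
    have hQJP : I.Q I.J < Real.exp (Real.log X ^ (97 / 100 : ℝ)) := by
      have h1 : I.Q I.J ≤ Real.exp (Real.sqrt (Real.log X)) :=
        I.Q_J_le.trans (Real.exp_le_exp.2 (Real.sqrt_le_sqrt (Real.log_le_log hX₀0 hX₀X)))
      refine h1.trans_lt (Real.exp_lt_exp.2 ?_)
      rw [Real.sqrt_eq_rpow]
      have hlogX1 : 1 < Real.log X := by
        rw [← Real.log_exp 1]; exact Real.log_lt_log (Real.exp_pos 1) (lt_of_lt_of_le (Real.exp_lt_exp.2 (by norm_num)) hXe4)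
      exact Real.rpow_lt_rpow_of_exponent_lt hlogX1 (by norm_num)
    have hfacU : ∀ m p : ℕ, p.Prime → Real.exp (Real.log X ^ (97 / 100 : ℝ)) ≤ p →
        (p : ℝ) ≤ Real.exp (Real.log X ^ (99 / 100 : ℝ)) → ¬ p ∣ m → a (m * p) = a m * f p := by
      intro m p hp hPp _ hpm
      have hm : m ≠ 0 := by rintro rfl; exact hpm (dvd_zero p)
      have hiff := I.mem_mul_prime_iff_of_gt hη hη8 hm hp (hQJP.trans_le hPp)
      simp only [ha]
      rw [hf m p]
      by_cases h : I.Mem m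
      · rw [if_pos (hiff.2 h), if_pos h]
      · rw [if_neg (fun h' => h (hiff.1 h')), if_neg h, zero_mul]
    -- `X₀`-conditions
    have hX₀e2 : Real.exp 2 ≤ X₀ := by
      refine le_trans ?_ hX₀
      have : Real.exp 2 = Real.sqrt (Real.exp 4) := by
        rw [show (4:ℝ) = 2 + 2 by norm_num, Real.exp_add, Real.sqrt_mul_self (Real.exp_pos 2).le]
      rw [this]; exact Real.sqrt_le_sqrt hXe4
    have hLX₀ : Real.log X ≤ 2 * Real.log X₀ := by
      have h1 : X ≤ X₀ ^ 2 := by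
        calc X = Real.sqrt X ^ 2 := (Real.sq_sqrt hX0.le).symm
          _ ≤ X₀ ^ 2 := pow_le_pow_left₀ hsX.le hX₀ 2
      calc Real.log X ≤ Real.log (X₀ ^ 2) := Real.log_le_log hX0 h1
        _ = 2 * Real.log X₀ := by rw [Real.log_pow]; ring
    -- the Halász input
    have hRin : ∀ v ∈ Icc ⌊Real.log X ^ (1 / 50 : ℝ) * Real.log (Real.exp (Real.log X ^ (97 / 100 : ℝ)))⌋₊
          ⌊Real.log X ^ (1 / 50 : ℝ) * Real.log (Real.exp (Real.log X ^ (99 / 100 : ℝ)))⌋₊,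
        ∀ t ∈ Set.Icc T₀ T,
          ‖blockCofactorPoly a X (Real.exp (Real.log X ^ (97 / 100 : ℝ))) (Real.exp (Real.log X ^ (99 / 100 : ℝ)))
              (Real.log X ^ (1 / 50 : ℝ)) v t‖ ≤ 2 ^ I.J * (3 * C₃ * Real.log X ^ (1 / 50 - 1 / 16 : ℝ)) := by
      intro v hv t ht
      exact hR η X₀ I f hf hf1 hfb t₁ ht₁ hmin t (hT₀.trans ht.1) (ht.2.trans hTX) (hfar t ht) v hv
    have hmain := hP1 X X₀ I a f b T₀ T hL₀ hX₀e2 hX₀X hLX₀ ha1 hb1 hfb hsupp hfac hfacU hT₀ hT₀T hT1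
      (by linarith) hRin
    -- the integrand
    have hsum : ∀ t : ℝ, ∑ n ∈ Icc ⌈X⌉₊ ⌊2 * X⌋₊, a n * (n : ℂ) ^ (-(1 + (t : ℂ) * Complex.I)) =
        restrDirichlet f I X t := by
      intro t
      unfold restrDirichlet
      rw [sum_filter]
      refine sum_congr rfl fun n _ => ?_
      simp only [ha]
      split_ifs <;> simp
    simp_rw [hsum] at hmain
    refine hmain.trans ?_
    have : C₁ * (T / (X / I.Q 1) + 1) * (E₁ + E₃) ≤ (C₁ + K') * (T / (X / I.Q 1) + 1) * (E₁ + E₃) := by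
      have h0 : 0 ≤ (T / (X / I.Q 1) + 1) * (E₁ + E₃) := by positivity
      nlinarith
    simpa only [hE₁, hE₃] using this

/-! ### Proposition A.3, Tao's Proposition 2.4 and the logarithmic Chowla/Elliott theorems from Khale's region -/

/-- **Proposition A.3 with middle term `K (1 + M) e^{-M/2}`, from the bound on `𝒯₂`.**  Assume Khale's theorem
(for the window `𝒯₀ ∪ 𝒯₁`, `integral_sq_restrDirichlet_window_le`) and the following form of "Matomäki–Radziwiłł's
Proposition 1 for complex `f` away from the minimiser" (the printed "In the region `|t - t₁| ≥ (log X)^{1/16}` …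
exactly the same way as [MR]", i.e. Lemma A.4 and MR §8 for the `𝒮`-restricted polynomial): for `η ∈ (0, 1/6)`
there are `C, Xη` such that for `X > Xη`, `√X ≤ X₀ ≤ X`, completely multiplicative `1`-bounded `f`, a minimiser
`t₁` of `u ↦ 𝔻(f, n^{iu}; X)²` on `|u| ≤ X`, and `0 ≤ T₀ ≤ T ≤ X/2` with `|t - t₁| ≥ (log X)^{1/16}` on `[T₀, T]`
(the form `T2half` of this file),
`∫_{T₀}^{T} |F(1+it)|² dt ≤ C (T/(X/Q₁) + 1) ((log Q₁)^{1/3}/P₁^{1/6-η} + (log X)^{-1/50})`.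
Then `MRT2015.PropA3With (fun M => K (1 + M) e^{-M/2})` holds for some `K ≥ 0`.
Proof (as printed): for `T ≥ X/2` the mean value theorem (`integral_restrDirichlet_trivial_le`,
`one_le_Q_one_mul_err`); for `T < X/2` split `[0, T]` at `a = clamp(t₁ - L)`, `b = clamp(t₁ + L)`, `L = (log X)^{1/16}`
(`clamp = max 0 ∘ min T`), use the hypothesis on `[0, a]` and `[b, T]` and the window bound on `[a, b]`.
[cite: MatomakiRadziwillTao2015, Appendix A, Proposition A.3 (proof)] -/
theorem propA3With_exp_half_of_T2half (hK : Khale2024_zeroFreeRegion)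
    (hT2 : ∀ η : ℝ, 0 < η → η < 1 / 6 → ∃ C Xη : ℝ, ∀ (X X₀ T₀ T t₁ : ℝ) (I : SieveIntervalSystem η X₀)
      (f : ArithmeticFunction ℂ), (∀ m n : ℕ, f (m * n) = f m * f n) → f 1 = 1 → (∀ n, ‖f n‖ ≤ 1) →
      Xη < X → Real.sqrt X ≤ X₀ → X₀ ≤ X → |t₁| ≤ X →
      pretentiousDistSq f (fun n : ℕ => (n : ℂ) ^ ((t₁ : ℂ) * Complex.I)) X = minPretentiousDistSq f X X →
      0 ≤ T₀ → T₀ ≤ T → T ≤ X / 2 →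
      (∀ t ∈ Set.Icc T₀ T, Real.log X ^ (1 / 16 : ℝ) ≤ |t - t₁|) →
      ∫ t in T₀..T, ‖restrDirichlet f I X t‖ ^ 2 ≤
        C * (T / (X / I.Q 1) + 1) *
          (Real.log (I.Q 1) ^ (1 / 3 : ℝ) / (I.P 1) ^ (1 / 6 - η) + 1 / Real.log X ^ (1 / 50 : ℝ))) :
    ∃ K : ℝ, 0 ≤ K ∧ PropA3With (fun M => K * (1 + M) * Real.exp (-M / 2)) := by
  obtain ⟨K, hK0, hWev⟩ := integral_sq_restrDirichlet_window_le hK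
  obtain ⟨Xw, hW⟩ := Filter.eventually_atTop.1 hWev
  refine ⟨K, hK0.le, ?_⟩
  intro η hη hη6
  obtain ⟨C₂, Xη, hT2'⟩ := hT2 η hη hη6
  refine ⟨2 * max C₂ 0 + K + 200, max (max Xη Xw) 64, ?_⟩
  intro X X₀ T I f hf hf1 hfb hXη hX₀ hX₀X hT0
  have hXη' : Xη < X := lt_of_le_of_lt ((le_max_left _ _).trans (le_max_left _ _)) hXη
  have hXw : Xw ≤ X := ((le_max_right _ _).trans (le_max_left _ _)).trans hXη.le
  have hX64 : 64 ≤ X := (le_max_right _ _).trans hXη.le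
  have hX0 : 0 < X := by linarith
  have hX1 : 1 ≤ X := by linarith
  have hη8 : η ≤ 8 := by linarith
  -- notation for the error terms
  set E₁ : ℝ := Real.log (I.Q 1) ^ (1 / 3 : ℝ) / I.P 1 ^ (1 / 6 - η) with hE₁
  set E₃ : ℝ := 1 / Real.log X ^ (1 / 50 : ℝ) with hE₃
  set M : ℝ := minPretentiousDistSq f X X with hMdef
  set mid : ℝ := K * (1 + M) * Real.exp (-M / 2) with hmid
  set R : ℝ := T / (X / I.Q 1) + 1 with hR
  have hQ1 : 1 ≤ I.Q 1 := I.one_le_Q hη hη8 le_rfl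
  have hQ0 : 0 < I.Q 1 := by linarith
  have hlogX : 0 < Real.log X := Real.log_pos (by linarith)
  have hP0 : 0 < I.P 1 := I.pos_P 1 le_rfl
  have hE₁0 : 0 ≤ E₁ := by
    have : 0 ≤ Real.log (I.Q 1) := Real.log_nonneg hQ1
    positivity
  have hE₃0 : 0 ≤ E₃ := by positivity
  have hM0 : 0 ≤ M := minPretentiousDistSq_nonneg hfb X hX0.le
  have hmid0 : 0 ≤ mid := by positivity
  have hR1 : 1 ≤ R := by
    have : 0 ≤ T / (X / I.Q 1) := by positivity
    linarith
  have hR0 : 0 ≤ R := by linarith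
  have hRdef : R = T * I.Q 1 / X + 1 := by rw [hR]; field_simp
  have hC₂ : C₂ ≤ max C₂ 0 := le_max_left _ _
  have hC₂0 : 0 ≤ max C₂ 0 := le_max_right _ _
  -- the goal, restated
  show ∫ t in (0 : ℝ)..T, ‖restrDirichlet f I X t‖ ^ 2 ≤ (2 * max C₂ 0 + K + 200) * R * (E₁ + mid + E₃)
  have hcont : Continuous fun t : ℝ => ‖restrDirichlet f I X t‖ ^ 2 :=
    ((continuous_restrDirichlet f I X).norm).pow 2
  have hint : ∀ a b : ℝ, IntervalIntegrable (fun t : ℝ => ‖restrDirichlet f I X t‖ ^ 2) volume a b :=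
    fun a b => hcont.intervalIntegrable _ _
  have hnn : ∀ a b : ℝ, a ≤ b → 0 ≤ ∫ t in a..b, ‖restrDirichlet f I X t‖ ^ 2 := fun a b hab =>
    intervalIntegral.integral_nonneg hab fun t _ => by positivity
  rcases le_or_gt (X / 2) T with hTX | hTX
  · -- `T ≥ X/2`: the trivial bound
    have hT : 0 < T := by linarith
    have h1 := integral_restrDirichlet_trivial_le hfb I hX1 le_rfl hT0 hT
    have h2 : 10 * T / X + 72 ≤ 154 * (T / X) := by
      have : 1 / 2 ≤ T / X := by rw [div_le_div_iff₀ (by norm_num) hX0]; linarith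
      have h' : 10 * T / X = 10 * (T / X) := by ring
      rw [h']; linarith
    have h3 : T / X ≤ R * E₁ := by
      have h4 := one_le_Q_one_mul_err I hη hη6
      have hTX0 : 0 ≤ T / X := by positivity
      calc T / X = T / X * 1 := (mul_one _).symm
        _ ≤ T / X * (I.Q 1 * E₁) := mul_le_mul_of_nonneg_left h4 hTX0
        _ = (T * I.Q 1 / X) * E₁ := by ring
        _ ≤ R * E₁ := by rw [hRdef]; exact mul_le_mul_of_nonneg_right (by linarith) hE₁0
    have h5 : R * E₁ ≤ R * (E₁ + mid + E₃) := mul_le_mul_of_nonneg_left (by linarith) hR0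
    have h6 : 0 ≤ R * (E₁ + mid + E₃) := by positivity
    nlinarith
  · -- `T < X/2`: split `[0, T]`
    obtain ⟨t₁, ht₁, -, heq⟩ := Halasz.Restricted.exists_isMinOn_pretentiousDistSq_twist hfb X hX0.le
    set L : ℝ := Real.log X ^ (1 / 16 : ℝ) with hL
    have hL0 : 0 < L := Real.rpow_pos_of_pos hlogX _
    set a : ℝ := max 0 (min T (t₁ - L)) with ha
    set b : ℝ := max 0 (min T (t₁ + L)) with hb
    have ha0 : 0 ≤ a := le_max_left _ _
    have hb0 : 0 ≤ b := le_max_left _ _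
    have haT : a ≤ T := max_le hT0 (min_le_left _ _)
    have hbT : b ≤ T := max_le hT0 (min_le_left _ _)
    have hab : a ≤ b := max_le_max le_rfl (min_le_min le_rfl (by linarith))
    -- the three pieces
    rw [← intervalIntegral.integral_add_adjacent_intervals (hint 0 a) (hint a T),
      ← intervalIntegral.integral_add_adjacent_intervals (hint a b) (hint b T)]
    -- piece `[0, a]`
    have hA : ∫ t in (0 : ℝ)..a, ‖restrDirichlet f I X t‖ ^ 2 ≤ max C₂ 0 * R * (E₁ + E₃) := by
      rcases eq_or_lt_of_le ha0 with h0 | h0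
      · rw [← h0, intervalIntegral.integral_same]; positivity
      · -- `a > 0`: `a = min T (t₁ - L) ≤ t₁ - L`
        have ha' : a ≤ t₁ - L := by
          have : a = min T (t₁ - L) := max_eq_right (le_of_lt (by
            rcases lt_or_ge 0 (min T (t₁ - L)) with h' | h'
            · exact h'
            · exfalso; rw [ha, max_eq_left h'] at h0; exact lt_irrefl _ h0))
          rw [this]; exact min_le_right _ _
        have hfar : ∀ t ∈ Set.Icc 0 a, L ≤ |t - t₁| := by
          intro t ht
          rw [abs_sub_comm, abs_of_nonneg (by linarith [ht.2])]
          linarith [ht.2]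
        have h := hT2' X X₀ 0 a t₁ I f hf hf1 hfb hXη' hX₀ hX₀X ht₁ heq le_rfl ha0 (by linarith) hfar
        refine h.trans ?_
        have hRa : a / (X / I.Q 1) + 1 ≤ R := by
          rw [hR]; gcongr
        have hRa0 : 0 ≤ a / (X / I.Q 1) + 1 := by positivity
        have hEE : 0 ≤ E₁ + E₃ := by positivity
        calc C₂ * (a / (X / I.Q 1) + 1) * (E₁ + E₃) ≤ max C₂ 0 * (a / (X / I.Q 1) + 1) * (E₁ + E₃) := by
              gcongr
          _ ≤ max C₂ 0 * R * (E₁ + E₃) := by gcongr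
    -- piece `[b, T]`
    have hB : ∫ t in b..T, ‖restrDirichlet f I X t‖ ^ 2 ≤ max C₂ 0 * R * (E₁ + E₃) := by
      rcases eq_or_lt_of_le hbT with h0 | h0
      · rw [h0, intervalIntegral.integral_same]; positivity
      · -- `b < T`: `b = max 0 (t₁ + L) ≥ t₁ + L`
        have hb' : t₁ + L ≤ b := by
          have hmin : min T (t₁ + L) = t₁ + L := by
            rcases le_or_gt T (t₁ + L) with h' | h'
            · exfalso
              have : b = T := by rw [hb, min_eq_left h', max_eq_right hT0]
              exact lt_irrefl _ (this ▸ h0)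
            · exact min_eq_right h'.le
          rw [hb, hmin]; exact le_max_right _ _
        have hfar : ∀ t ∈ Set.Icc b T, L ≤ |t - t₁| := by
          intro t ht
          rw [abs_of_nonneg (by linarith [ht.1])]
          linarith [ht.1]
        have h := hT2' X X₀ b T t₁ I f hf hf1 hfb hXη' hX₀ hX₀X ht₁ heq hb0 hbT (by linarith) hfar
        refine h.trans ?_
        have hEE : 0 ≤ E₁ + E₃ := by positivity
        gcongr
    -- piece `[a, b]`: the window
    have hWin : ∫ t in a..b, ‖restrDirichlet f I X t‖ ^ 2 ≤ K * ((1 + M) * Real.exp (-M / 2) + E₃) := by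
      rcases eq_or_lt_of_le hab with h0 | h0
      · rw [← h0, intervalIntegral.integral_same]; positivity
      · -- `a < b`: `a ≥ t₁ - L` (as `a < T`) and `b ≤ t₁ + L` (as `b > 0`)
        have ha' : t₁ - L ≤ a := by
          have haT' : a < T := lt_of_lt_of_le h0 hbT
          have hmin : min T (t₁ - L) = t₁ - L := by
            rcases le_or_gt T (t₁ - L) with h' | h'
            · exfalso
              have : a = T := by rw [ha, min_eq_left h', max_eq_right hT0]
              exact lt_irrefl _ (this ▸ haT')
            · exact min_eq_right h'.le
          rw [ha, hmin]; exact le_max_right _ _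
        have hb' : b ≤ t₁ + L := by
          have hb0' : 0 < b := lt_of_le_of_lt ha0 h0
          have : b = min T (t₁ + L) := max_eq_right (le_of_lt (by
            rcases lt_or_ge 0 (min T (t₁ + L)) with h' | h'
            · exact h'
            · exfalso; rw [hb, max_eq_left h'] at hb0'; exact lt_irrefl _ hb0'))
          rw [this]; exact min_le_right _ _
        exact hW X hXw η X₀ I f hη (by linarith) hf hf1 hfb hX₀ hX₀X t₁ a b heq.le hab ha' hb'
          (by linarith) (by linarith)
    -- combine
    have hWin' : K * ((1 + M) * Real.exp (-M / 2) + E₃) ≤ R * (mid + K * E₃) := by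
      have h1 : K * ((1 + M) * Real.exp (-M / 2) + E₃) = mid + K * E₃ := by rw [hmid]; ring
      rw [h1]
      exact le_mul_of_one_le_left (by positivity) hR1
    have hsum := add_le_add hA (add_le_add hWin hB)
    refine hsum.trans ?_
    clear hsum hA hB hWin hW hT2' hint hcont hnn heq
    have h1 : 0 ≤ max C₂ 0 * R * mid := by positivity
    have h2 : 0 ≤ K * R * E₁ := by positivity
    have h3 : 0 ≤ K * R * mid := by positivity
    have h4 : 0 ≤ R * mid := by positivity
    have h5 : 0 ≤ R * E₁ := by positivity
    have h6 : 0 ≤ R * E₃ := by positivity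
    linarith [hWin', h1, h2, h3, h4, h5, h6]


/-- **Proposition A.3 with the restricted-Halász middle term, from Khale's region**:
`∃ K ≥ 0, MRT2015.PropA3With (fun M => K (1 + M) e^{-M/2})`. [cite: MatomakiRadziwillTao2015, Appendix A, Proposition A.3] -/
theorem propA3With_exp_half_of_khale (hK : Khale2024_zeroFreeRegion) :
    ∃ K : ℝ, 0 ≤ K ∧ PropA3With (fun M => K * (1 + M) * Real.exp (-M / 2)) :=
  propA3With_exp_half_of_T2half hK (T2half hK)

/-- **Tao 2016, Proposition 2.4, from Khale's explicit Vinogradov–Korobov zero-free region** — the whole chain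
Matomäki–Radziwiłł §8 for complex `f` on `𝒯₂` + the restricted-Halász window (Proposition A.3 with middle term
`(1 + M) e^{-M/2}`) → Theorem A.2 → the major arcs with `W ≤ e^{M/12}` → MRT Theorem 1.7 (saving `e^{-M/120}`) →
Proposition 2.4, all proved in the tree. [cite: TaoFMP2016, Proposition 2.4] -/
theorem Tao2016_prop24_of_khale (hK : Khale2024_zeroFreeRegion) : Tao2016_prop24 := by
  obtain ⟨K, hK0, h⟩ := propA3With_exp_half_of_khale hK
  exact Tao2016_prop24_of_propA3With_exp_half hK0 h

/-- Tao 2016, Theorem 2.3, from Khale's region. [cite: TaoFMP2016, Theorem 2.3] -/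
theorem Tao2016_theorem23_of_khale (hK : Khale2024_zeroFreeRegion) : Tao2016_theorem23 :=
  Tao2016_theorem23_of_prop24 (Tao2016_prop24_of_khale hK)

/-- Tao 2016, Theorem 1.3 (two-point logarithmically averaged Elliott), from Khale's region. [cite: TaoFMP2016, Theorem 1.3] -/
theorem tao_log_averaged_elliott_two_of_khale (hK : Khale2024_zeroFreeRegion) : tao_log_averaged_elliott_two :=
  tao_log_averaged_elliott_two_of_prop24 (Tao2016_prop24_of_khale hK)

/-- The logarithmically averaged binary Chowla conjecture (`tao_log_chowla_two`), from Khale's region.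
[cite: TaoFMP2016, Corollary 1.5] -/
theorem tao_log_chowla_two_of_khale (hK : Khale2024_zeroFreeRegion) : tao_log_chowla_two :=
  tao_log_chowla_two_of_prop24 (Tao2016_prop24_of_khale hK)

/-- parity.S21 for Liouville (`Sieve.tao_log_chowla_liouville`), from Khale's region. [cite: TaoFMP2016, Theorem 1.2] -/
theorem tao_log_chowla_liouville_of_khale (hK : Khale2024_zeroFreeRegion) : Sieve.tao_log_chowla_liouville :=
  tao_log_chowla_liouville_of_prop24 (Tao2016_prop24_of_khale hK)

/-- parity.S21 for Möbius (`Sieve.tao_log_chowla_moebius`), from Khale's region. [cite: TaoFMP2016, Theorem 1.2] -/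
theorem tao_log_chowla_moebius_of_khale (hK : Khale2024_zeroFreeRegion) : Sieve.tao_log_chowla_moebius :=
  tao_log_chowla_moebius_of_prop24 (Tao2016_prop24_of_khale hK)

end MRT2015

end Literature.NumberTheory.LFunctions
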